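/-
Copyright (c) 2026 the pub-hodgecm-mathlib formalisation cell (harness21).  Prover seat hodgecm-mathlib-R90-CS-p03 (g2), R90-TF section S8 «ContSpec-n½» (dealer R90-CS-plan (g3),
S8-R128 (8) «(a-2a) then (a-2b) global assembly»; census `R90/S8/CENSUS-ChiFiniteTransportU3.R90-CS-p03-g2.md`, file (a-2b)): the χ-TWIN of ★ (3-iv-c) `K2E1IntertwiningScalarEulerProductU3` —
the normalised unipotent integral of ANY big-cell-factorised integrand is (archimedean double integral) × (bad-place χ-means) × `c_χ^S(z)`, HYPOTHESIS-FIRST on the section-factorisation letter.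
-/
import Summits.HodgeConjecture.HodgeConjecture.Theorems.K2E1ChiIntertwiningFiniteTransportU3    -- ★ (a-2a) (this seat): `exists_pos_integral_prod_chiWeight_mul_heightFactor_cpow_eq`; brings ★ (a-1), ★ (3-iv-b), ★ (a2)₃'s `heisZ` currency
import Summits.HodgeConjecture.HodgeConjecture.Theorems.K2E1UnipotentHaarNormalisationU3       -- ★ (ν-1) p857963: `inv_measure_smul_integral_eq_heisChart_traceZeroLine_three` (any integrable `T`)
import Summits.HodgeConjecture.HodgeConjecture.Theorems.K2E1AdelicFourierEnvelope              -- ★ `exists_integral_adele_eq_smul_integral_prod` (`∫_𝔸 = c ∫∫_{∞ × f}`)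
import HarnessLib

/-!
# K2·E1 ∕ R90·S8 — `K2E1ChiIntertwiningScalarEulerProductU3` (file (a-2b)): THE χ-INTERTWINING INTEGRAL OF `U(2,1)_{L∕L⁺}` IS (ARCHIMEDEAN INTEGRAL) × (EULER PRODUCT) —
# `(ν𝓕)⁻¹ • ∫_{N(𝔸_{L⁺})} T dν = C · (∫_{L_∞}∫_{L⁺_∞} A_∞) · (∏_{v∈S₀} m_v(z)) · [P_L^S(z−1;φ)P_{L⁺}^{S₀}(2z−2;η)] ∕ [P_L^S(z;φ)P_{L⁺}^{S₀}(2z−1;η)]` for ANY `T` factorised on the big cell as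
# `T(u(X, θ s)) = A_∞(X_∞, s_∞) · Ω(X_f, s_f) · h_f(X, s_f)^{−z}` with a PURE-TENSOR finite weight `Ω = ∏ᶠ_v ω_v` (`2 < Re z`)

Cell `pub/hodgecm-mathlib`, crux h413 = `stmt-HodgeConjecture-24833`, route of record `HCCMUnconditional`; R90-TF section S8 «ContSpec-n½», road R2-χ₃ (the (V) scalar road: the seam
★ `R90S8ResGMidBlockNeBotOfLettersU3` takes ★ F5's `hsrc : ∀ z, 2 < Re z → q z = A z · c_χ^S(z)`; with `T :=` the χ-section `f_z^χ(ι(w₀)·)` on `N(𝔸)` this file IS that shape, with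
`A z := C · (∫∫ A_∞) · ∏_{v∈S₀} m_v(z)` explicit).  THEOREMS ONLY (no `def`, no `instance`, no notation, no named-fact hypothesis, no `sorry`; default heartbeats); lane
`--supports stmt-HodgeConjecture-24833 --as helper` (count-neutral).  Closes no socket.  TEMPLATE: ★ (3-iv-c) `K2E1IntertwiningScalarEulerProductU3` (K2E2-p12), line by line — the
spherical height `H(ι(w₀)·)^σ` and its pointwise big-cell formula (★ (a2)₃) are replaced by an ARBITRARY integrable `T` and the factorisation LETTER `hfac`.

THE MATHEMATICS ([MoeglinWaldspurger1995] II.1.6–II.1.7, IV.1.11; [Langlands1971] §3; [Rogawski1990] §4.5, §7.3, §13.9 p. 229; [TateThesis1967] Thm 3.3.1).  THE CHAIN: ★ (ν-1)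
`inv_measure_smul_integral_eq_heisChart_traceZeroLine_three` (two-layer unfolding of `N(𝔸)` along the Heisenberg chart `u(X, θ s)` and the trace-zero line, ANY integrable `T`) ∘ the letter
`hfac` (on the big cell the integrand is an archimedean factor `A_∞(X_∞, s_∞)` times a finite weight `Ω(X_f, s_f)` times ★ (a2)₃'s finite height factor `h_f(X, s_f)` to the power `−z` — for the
χ-section this is the Iwasawa reading `f_z^χ(ι(w₀)u) = χ(m(ι(w₀)u))·H(ι(w₀)u)^z`, the supplier's business) ∘ Mathlib `integral_prod_mul` twice along ★ `exists_integral_adele_eq_smul_integral_prod`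
(`𝔸 = ∞ × f` for `L` and for `L⁺`) ∘ Mathlib `integral_prod` (the one place integrability is used: letter `hfin`) ∘ ★ (a-2a) `exists_pos_integral_prod_chiWeight_mul_heightFactor_cpow_eq`
(= ★ (3-iv-b) §1 transport ∘ ★ cpow dictionary ∘ ★ (a-1) Tate 3.3.1 + good-place tokens; letters `hgood hωc hω1 hΩ hin hsp`).
* **`exists_pos_inv_measure_smul_integral_eq_chiEulerProduct_three`** (HEAD): ONE constant `C > 0` (Haar normalisations only) with, for every bad finset `S₀` (`hgood` = ★ (a-1) HEAD's
  bytes), every `z` with `2 < Re z`, every local weight family `ω` (`hωc hω1`), archimedean factor `A_∞`, pure-tensor finite weight `Ω` (`hΩ`), every `ν`-integrable `T` factorised by `hfac`,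
  with `hfin` and the token letters `hin hsp` (★ (a-1)'s bytes; payable by ★ `K2E1ChiLocalMeansOfShellU3Letters`):
  `(ν𝓕)⁻¹ • ∫_{N(𝔸)} T dν = C · (∫_{L_∞}∫_{L⁺_∞} A_∞ dμ_{F,∞} dμ_{E,∞}) · ((∏_{v∈S₀} m_v(z)) · c_χ^S(z))`, ★ (a-1)'s right side VERBATIM.
HONEST SCOPE.  NOT here: the letters themselves — `hfac` (the χ-section's big-cell factorisation with `Ω`, `A_∞`; χ-twin of ★ (a2)₃), `hT`∕`hfin` (Godement-type integrability, χ-twin of ★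
`K2E1IntertwiningGrowthU3`), `hΩ`, `hin hsp` (★ Letters ∘ Iwasawa witnesses), nor ★ F5's `hA` (holomorphy of `z ↦ C·(∫∫A_∞)·∏_{S₀} m_v(z)` on `{1 < Re}`) and `A(3∕2) ≠ 0` — named for the dealer.
HONEST LABEL: HC_CM is proved only modulo the 7 printed citations (2 remaining named inputs: hLiu418 = `stmt-HodgeConjecture-24832`, h413 = `stmt-HodgeConjecture-24833`) until rung 0
closes; REL ≠ ★ ≠ BUILT; this file asserts no named fact and closes no socket; count-neutral; conditional only on its displayed letters.

## References
* [MoeglinWaldspurger1995] C. Mœglin, J.-L. Waldspurger, *Spectral Decomposition and Eisenstein Series* (1995): II.1.6–II.1.7, IV.1.11.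
* [Langlands1971] R. P. Langlands, *Euler Products* (1971): §3.
* [Rogawski1990] J. D. Rogawski, *Automorphic Representations of Unitary Groups in Three Variables*, Ann. of Math. Stud. 123 (1990): §4.5, §7.3, §13.9 p. 229.
* [TateThesis1967] J. Tate, *Fourier analysis in number fields and Hecke's zeta-functions* (1967): Thm 3.3.1.
* [Langlands1976] R. P. Langlands, *On the Functional Equations Satisfied by Eisenstein Series*, LNM 544 (1976): Appendix (rank one).
-/

set_option autoImplicit false
set_option linter.dupNamespace false -- the mandated namespace repeats `HodgeConjecture.HodgeConjecture`

noncomputable section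

open MeasureTheory MeasureTheory.Measure NumberField NumberField.InfinitePlace IsDedekindDomain Filter
open scoped NNReal ENNReal Classical
open Literature.NumberTheory.Automorphic Literature.NumberTheory.Automorphic.UnitaryGroup Literature.NumberTheory.GaloisRepresentations
open Literature.NumberTheory.GaloisRepresentations.IsNonarchimedeanLocalField Literature.NumberTheory.LFunctions
open Summit.HodgeConjecture.HodgeConjecture.Cruxes.H413
open Summit.HodgeConjecture.HodgeConjecture.Cruxes.H413.K2E1UnipotentHaarNormalisationU3 (inv_measure_smul_integral_eq_heisChart_traceZeroLine_three)
open Summit.HodgeConjecture.HodgeConjecture.Cruxes.H413.K2E1AdelicFourierEnvelope (exists_integral_adele_eq_smul_integral_prod)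
open Summit.HodgeConjecture.HodgeConjecture.Cruxes.H413.K2E1ChiIntertwiningFiniteTransportU3 (exists_pos_integral_prod_chiWeight_mul_heightFactor_cpow_eq)

namespace Summit.HodgeConjecture.HodgeConjecture.Cruxes.H413.K2E1ChiIntertwiningScalarEulerProductU3

variable (L : Type) [Field L] [NumberField L] [IsCMField L] (hc : IsCMField.complexConj L * IsCMField.complexConj L = 1)
  {δ : L} (hcδ : IsCMField.complexConj L δ = -δ) (hδ : δ ≠ 0)

include hc in
/-- **THE χ-INTERTWINING INTEGRAL OF `U(2,1)` OVER THE CM FIELD `L`, ASSEMBLED: (ARCHIMEDEAN INTEGRAL) × (EULER PRODUCT), FOR ANY BIG-CELL-FACTORISED INTEGRAND.**  For every Haar `ν` of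
`N(𝔸_{L⁺})` with a fundamental domain `𝓕` for `N(L⁺)`, all additive Haar measures `μ_E, μ_{E,∞}, μ_{E,f}` (`E = L`), `μ_F, μ_{F,∞}, μ_{F,f}` (`F = L⁺`), local Haar measures `ν_v`, and a
unitary Hecke character `φ` of `L` restricting to `ψ` (`hres`) with `ψ·ω_{L∕L⁺}` unitary, there is ONE constant `C > 0` such that for every bad finset `S₀` (`hgood`), every `z` with
`2 < Re z`, every local weight family `ω` (`hωc`, `hω1`), every archimedean factor `A_∞`, every finite weight `Ω` with the pure-tensor letter `hΩ : Ω(Ψ^∞(x₀,x₁), x₂) = ∏ᶠ_v ω_v(x_v)`, and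
every `ν`-integrable `T : N(𝔸) → ℂ` FACTORISED ON THE BIG CELL by `hfac : T(u(X, θ s)) = A_∞(X_∞, s_∞)·(Ω(X_f, s_f)·h_f(X, s_f)^{−z})`, IF the finite part `Ω·h_f^{−z}` is
`μ_{E,f} ⊗ μ_{F,f}`-integrable (`hfin`) and the good-place tokens hold (`hin`, `hsp`) THEN
`(ν𝓕)⁻¹ • ∫_{N(𝔸)} T dν = C · (∫_{L_∞}∫_{L⁺_∞} A_∞ dμ_{F,∞} dμ_{E,∞}) · ((∏_{v ∈ S₀} ν_v(𝒪_v³)⁻¹ • ∫ ω_v Q_v^{−z}) · [P_L^S(z−1;φ)·P_{L⁺}^{S₀}(2z−2;η)] ∕ [P_L^S(z;φ)·P_{L⁺}^{S₀}(2z−1;η)])`,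
`η := ψ·ω_{L∕L⁺}`, `S := {w ∣ w ∩ 𝓞L⁺ ∈ S₀}` (★ (a-1)'s `partialStandardL` currency VERBATIM).  (★ (ν-1) ∘ `hfac` ∘ ★ `exists_integral_adele_eq_smul_integral_prod` ×2 ∘ `integral_prod_mul` ×2
∘ `integral_prod` ∘ ★ (a-2a).) [cite: MoeglinWaldspurger1995, II.1.7, IV.1.11] [cite: Langlands1971, §3] [cite: Rogawski1990, §13.9 p. 229] [cite: TateThesis1967, Thm 3.3.1] -/
theorem exists_pos_inv_measure_smul_integral_eq_chiEulerProduct_three {d : ↥(maximalRealSubfield L)} (hd : δ * δ = algebraMap ↥(maximalRealSubfield L) L d)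
    [MeasurableSpace ↥(adelicUnipotent ↥(maximalRealSubfield L) L (IsCMField.complexConj L) 3)] [BorelSpace ↥(adelicUnipotent ↥(maximalRealSubfield L) L (IsCMField.complexConj L) 3)]
    [MeasurableSpace (AdeleRing (𝓞 L) L)] [BorelSpace (AdeleRing (𝓞 L) L)]
    [MeasurableSpace (AdeleRing (𝓞 ↥(maximalRealSubfield L)) ↥(maximalRealSubfield L))] [BorelSpace (AdeleRing (𝓞 ↥(maximalRealSubfield L)) ↥(maximalRealSubfield L))]
    [MeasurableSpace (InfiniteAdeleRing L)] [BorelSpace (InfiniteAdeleRing L)]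
    [MeasurableSpace (InfiniteAdeleRing ↥(maximalRealSubfield L))] [BorelSpace (InfiniteAdeleRing ↥(maximalRealSubfield L))]
    [MeasurableSpace (FiniteAdeleRing (𝓞 L) L)] [BorelSpace (FiniteAdeleRing (𝓞 L) L)]
    [MeasurableSpace (FiniteAdeleRing (𝓞 ↥(maximalRealSubfield L)) ↥(maximalRealSubfield L))] [BorelSpace (FiniteAdeleRing (𝓞 ↥(maximalRealSubfield L)) ↥(maximalRealSubfield L))]
    [∀ v : HeightOneSpectrum (𝓞 ↥(maximalRealSubfield L)), MeasurableSpace (v.adicCompletion ↥(maximalRealSubfield L))] [∀ v : HeightOneSpectrum (𝓞 ↥(maximalRealSubfield L)), BorelSpace (v.adicCompletion ↥(maximalRealSubfield L))]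
    (ν : Measure ↥(adelicUnipotent ↥(maximalRealSubfield L) L (IsCMField.complexConj L) 3)) [ν.IsHaarMeasure]
    {𝓕 : Set ↥(adelicUnipotent ↥(maximalRealSubfield L) L (IsCMField.complexConj L) 3)} (h𝓕 : IsFundamentalDomain ↥(rationalUnipotent ↥(maximalRealSubfield L) L (IsCMField.complexConj L) 3) 𝓕 ν)
    (μE : Measure (AdeleRing (𝓞 L) L)) [μE.IsAddHaarMeasure] (μE₁ : Measure (InfiniteAdeleRing L)) [μE₁.IsAddHaarMeasure]
    (μE₂ : Measure (FiniteAdeleRing (𝓞 L) L)) [μE₂.IsAddHaarMeasure]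
    (μF : Measure (AdeleRing (𝓞 ↥(maximalRealSubfield L)) ↥(maximalRealSubfield L))) [μF.IsAddHaarMeasure] (μF₁ : Measure (InfiniteAdeleRing ↥(maximalRealSubfield L))) [μF₁.IsAddHaarMeasure]
    (μF₂ : Measure (FiniteAdeleRing (𝓞 ↥(maximalRealSubfield L)) ↥(maximalRealSubfield L))) [μF₂.IsAddHaarMeasure]
    (νv : ∀ v : HeightOneSpectrum (𝓞 ↥(maximalRealSubfield L)), Measure (v.adicCompletion ↥(maximalRealSubfield L))) [∀ v, (νv v).IsAddHaarMeasure]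
    {φ : HeckeCharacter L} {ψ : HeckeCharacter ↥(maximalRealSubfield L)} (hφ : φ.IsUnitary) (hψ : (ψ * quadraticHeckeCharCM L).IsUnitary)
    (hres : ∀ x, φ (AdeleRing.ideleBaseChange ↥(maximalRealSubfield L) L x) = ψ x) :
    ∃ C : ℝ, 0 < C ∧ ∀ (S₀ : Finset (HeightOneSpectrum (𝓞 ↥(maximalRealSubfield L))))
      (hgood : ∀ v ∉ S₀, (Algebra.IsUnramifiedIn (𝓞 L) v.asIdeal ∧ Valued.v (2 : v.adicCompletion ↥(maximalRealSubfield L)) = 1 ∧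
        ∀ w : PlacesOver L v, Valued.v (algebraMap L (LocalRing L v) δ w) = 1) ∧ ∀ w : PlacesOver L v, φ.IsUnramifiedAt w.1)
      {z : ℂ} (hz : 2 < z.re)
      (ω : ∀ v : HeightOneSpectrum (𝓞 ↥(maximalRealSubfield L)), (Fin 3 → v.adicCompletion ↥(maximalRealSubfield L)) → ℂ)
      (hωc : ∀ v, Continuous fun p : Fin 3 → v.adicCompletion ↥(maximalRealSubfield L) =>
        ω v p * (((∏ w' : PlacesOver L v, max 1 (max ((normAbs (w'.1.adicCompletion L) (quadraticLocalEquiv L v (IsCMField.complexConj L) hcδ hδ (p 0, p 1) w') : ℝ≥0) : ℝ)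
            ((normAbs (w'.1.adicCompletion L) ((toLocalRing L v (p 2) * algebraMap L (LocalRing L v) δ -
              toLocalRing L v 2⁻¹ * (quadraticLocalEquiv L v (IsCMField.complexConj L) hcδ hδ (p 0, p 1) *
                conjLocal L (IsCMField.complexConj L) v (quadraticLocalEquiv L v (IsCMField.complexConj L) hcδ hδ (p 0, p 1)))) w') : ℝ≥0) : ℝ))) : ℝ) : ℂ) ^ (-z))
      (hω1 : ∀ v ∉ S₀, ∀ p ∈ integralBox ↥(maximalRealSubfield L) (Fin 3) v, ω v p = 1)
      (Ainf : InfiniteAdeleRing L → InfiniteAdeleRing ↥(maximalRealSubfield L) → ℂ)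
      (Ω : FiniteAdeleRing (𝓞 L) L → FiniteAdeleRing (𝓞 ↥(maximalRealSubfield L)) ↥(maximalRealSubfield L) → ℂ)
      (hΩ : ∀ x : Fin 3 → FiniteAdeleRing (𝓞 ↥(maximalRealSubfield L)) ↥(maximalRealSubfield L),
        Ω (quadraticFiniteAdeleMap ↥(maximalRealSubfield L) L δ (x 0, x 1)) (x 2) = ∏ᶠ v : HeightOneSpectrum (𝓞 ↥(maximalRealSubfield L)), ω v (fun i => x i v))
      (T : ↥(adelicUnipotent ↥(maximalRealSubfield L) L (IsCMField.complexConj L) 3) → ℂ) (hT : Integrable T ν)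
      (hfac : ∀ (X : AdeleRing (𝓞 L) L) (s : AdeleRing (𝓞 ↥(maximalRealSubfield L)) ↥(maximalRealSubfield L)),
        T (heisChart hc (X, traceZeroLine ↥(maximalRealSubfield L) L (IsCMField.complexConj L) hcδ hδ s)) =
          Ainf (X.1) (s.1) * (Ω (X.2) (s.2) * ((((∏ᶠ w : HeightOneSpectrum (𝓞 L), max 1 (max ‖((X) : AdeleRing (𝓞 L) L).2 w‖₊ ‖(heisZ (c := IsCMField.complexConj L) ((X) : AdeleRing (𝓞 L) L) ((traceZeroLine ↥(maximalRealSubfield L) L (IsCMField.complexConj L) hcδ hδ ((0, s.2) : AdeleRing (𝓞 ↥(maximalRealSubfield L)) ↥(maximalRealSubfield L)) : traceZeroAdele ↥(maximalRealSubfield L) L (IsCMField.complexConj L)) : AdeleRing (𝓞 L) L)).2 w‖₊) : ℝ≥0) : ℝ) : ℂ) ^ (-z))))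
      (hfin : Integrable (fun q : FiniteAdeleRing (𝓞 L) L × FiniteAdeleRing (𝓞 ↥(maximalRealSubfield L)) ↥(maximalRealSubfield L) =>
        (Ω (q.1) (q.2) * ((((∏ᶠ w : HeightOneSpectrum (𝓞 L), max 1 (max ‖((((0 : InfiniteAdeleRing L)), q.1) : AdeleRing (𝓞 L) L).2 w‖₊ ‖(heisZ (c := IsCMField.complexConj L) ((((0 : InfiniteAdeleRing L)), q.1) : AdeleRing (𝓞 L) L) ((traceZeroLine ↥(maximalRealSubfield L) L (IsCMField.complexConj L) hcδ hδ ((0, q.2) : AdeleRing (𝓞 ↥(maximalRealSubfield L)) ↥(maximalRealSubfield L)) : traceZeroAdele ↥(maximalRealSubfield L) L (IsCMField.complexConj L)) : AdeleRing (𝓞 L) L)).2 w‖₊) : ℝ≥0) : ℝ) : ℂ) ^ (-z)))) (μE₂.prod μF₂))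
      (hin : ∀ v ∉ S₀, ∀ w : PlacesOver L v, IsCMField.complexConj L • w.1 = w.1 →
        ((Measure.pi fun _ : Fin 3 => νv v) (integralBox ↥(maximalRealSubfield L) (Fin 3) v)).toReal⁻¹ •
            ∫ p : Fin 3 → v.adicCompletion ↥(maximalRealSubfield L),
              ω v p * (((∏ w' : PlacesOver L v, max 1 (max ((normAbs (w'.1.adicCompletion L) (quadraticLocalEquiv L v (IsCMField.complexConj L) hcδ hδ (p 0, p 1) w') : ℝ≥0) : ℝ)
                ((normAbs (w'.1.adicCompletion L) ((toLocalRing L v (p 2) * algebraMap L (LocalRing L v) δ -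
                  toLocalRing L v 2⁻¹ * (quadraticLocalEquiv L v (IsCMField.complexConj L) hcδ hδ (p 0, p 1) *
                    conjLocal L (IsCMField.complexConj L) v (quadraticLocalEquiv L v (IsCMField.complexConj L) hcδ hδ (p 0, p 1)))) w') : ℝ≥0) : ℝ))) : ℝ) : ℂ) ^ (-z)
              ∂(Measure.pi fun _ : Fin 3 => νv v) =
          (1 - φ.valueAtUniformizer w.1 * (v.residueCard : ℂ) ^ (-(2 * z))) * (1 + φ.valueAtUniformizer w.1 * (v.residueCard : ℂ) ^ (-(2 * z - 1))) /
            ((1 - φ.valueAtUniformizer w.1 * (v.residueCard : ℂ) ^ (-(2 * z - 2))) * (1 + φ.valueAtUniformizer w.1 * (v.residueCard : ℂ) ^ (-(2 * z - 2)))))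
      (hsp : ∀ v ∉ S₀, ∀ w : PlacesOver L v, IsCMField.complexConj L • w.1 ≠ w.1 →
        ((Measure.pi fun _ : Fin 3 => νv v) (integralBox ↥(maximalRealSubfield L) (Fin 3) v)).toReal⁻¹ •
            ∫ p : Fin 3 → v.adicCompletion ↥(maximalRealSubfield L),
              ω v p * (((∏ w' : PlacesOver L v, max 1 (max ((normAbs (w'.1.adicCompletion L) (quadraticLocalEquiv L v (IsCMField.complexConj L) hcδ hδ (p 0, p 1) w') : ℝ≥0) : ℝ)
                ((normAbs (w'.1.adicCompletion L) ((toLocalRing L v (p 2) * algebraMap L (LocalRing L v) δ -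
                  toLocalRing L v 2⁻¹ * (quadraticLocalEquiv L v (IsCMField.complexConj L) hcδ hδ (p 0, p 1) *
                    conjLocal L (IsCMField.complexConj L) v (quadraticLocalEquiv L v (IsCMField.complexConj L) hcδ hδ (p 0, p 1)))) w') : ℝ≥0) : ℝ))) : ℝ) : ℂ) ^ (-z)
              ∂(Measure.pi fun _ : Fin 3 => νv v) =
          (1 - φ.valueAtUniformizer w.1 * (v.residueCard : ℂ) ^ (-z)) * (1 - φ.valueAtUniformizer (PlacesOver.galInv (IsCMField.complexConj L) w).1 * (v.residueCard : ℂ) ^ (-z)) *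
              (1 - φ.valueAtUniformizer w.1 * φ.valueAtUniformizer (PlacesOver.galInv (IsCMField.complexConj L) w).1 * (v.residueCard : ℂ) ^ (-(2 * z - 1))) /
            ((1 - φ.valueAtUniformizer w.1 * (v.residueCard : ℂ) ^ (-(z - 1))) * (1 - φ.valueAtUniformizer (PlacesOver.galInv (IsCMField.complexConj L) w).1 * (v.residueCard : ℂ) ^ (-(z - 1))) *
              (1 - φ.valueAtUniformizer w.1 * φ.valueAtUniformizer (PlacesOver.galInv (IsCMField.complexConj L) w).1 * (v.residueCard : ℂ) ^ (-(2 * z - 2))))),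
      ((ν 𝓕).toReal⁻¹ : ℝ) • ∫ v : ↥(adelicUnipotent ↥(maximalRealSubfield L) L (IsCMField.complexConj L) 3), T v ∂ν =
        (C : ℂ) * (∫ Xi : InfiniteAdeleRing L, ∫ a : InfiniteAdeleRing ↥(maximalRealSubfield L), Ainf Xi a ∂μF₁ ∂μE₁) *
          ((∏ v ∈ S₀, ((Measure.pi fun _ : Fin 3 => νv v) (integralBox ↥(maximalRealSubfield L) (Fin 3) v)).toReal⁻¹ •
          ∫ p : Fin 3 → v.adicCompletion ↥(maximalRealSubfield L),
            ω v p * (((∏ w' : PlacesOver L v, max 1 (max ((normAbs (w'.1.adicCompletion L) (quadraticLocalEquiv L v (IsCMField.complexConj L) hcδ hδ (p 0, p 1) w') : ℝ≥0) : ℝ)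
              ((normAbs (w'.1.adicCompletion L) ((toLocalRing L v (p 2) * algebraMap L (LocalRing L v) δ -
                toLocalRing L v 2⁻¹ * (quadraticLocalEquiv L v (IsCMField.complexConj L) hcδ hδ (p 0, p 1) *
                  conjLocal L (IsCMField.complexConj L) v (quadraticLocalEquiv L v (IsCMField.complexConj L) hcδ hδ (p 0, p 1)))) w') : ℝ≥0) : ℝ))) : ℝ) : ℂ) ^ (-z)
            ∂(Measure.pi fun _ : Fin 3 => νv v)) *
        ((partialStandardL {w : HeightOneSpectrum (𝓞 L) | w.under (𝓞 ↥(maximalRealSubfield L)) ∈ (↑S₀ : Set (HeightOneSpectrum (𝓞 ↥(maximalRealSubfield L))))} (fun w => {φ.valueAtUniformizer w}) (z - 1) *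
            partialStandardL (↑S₀ : Set (HeightOneSpectrum (𝓞 ↥(maximalRealSubfield L)))) (fun v => {(ψ * quadraticHeckeCharCM L).valueAtUniformizer v}) (2 * z - 2)) /
          (partialStandardL {w : HeightOneSpectrum (𝓞 L) | w.under (𝓞 ↥(maximalRealSubfield L)) ∈ (↑S₀ : Set (HeightOneSpectrum (𝓞 ↥(maximalRealSubfield L))))} (fun w => {φ.valueAtUniformizer w}) z *
            partialStandardL (↑S₀ : Set (HeightOneSpectrum (𝓞 ↥(maximalRealSubfield L)))) (fun v => {(ψ * quadraticHeckeCharCM L).valueAtUniformizer v}) (2 * z - 1)))) := by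
  haveI : SecondCountableTopology (FiniteAdeleRing (𝓞 ↥(maximalRealSubfield L)) ↥(maximalRealSubfield L)) := secondCountableTopology_finiteAdeleRing _
  haveI : LocallyCompactSpace (FiniteAdeleRing (𝓞 ↥(maximalRealSubfield L)) ↥(maximalRealSubfield L)) := locallyCompactSpace_finiteAdeleRing' _
  haveI : SecondCountableTopology (FiniteAdeleRing (𝓞 L) L) := secondCountableTopology_finiteAdeleRing L
  haveI : LocallyCompactSpace (FiniteAdeleRing (𝓞 L) L) := locallyCompactSpace_finiteAdeleRing' L
  haveI : SecondCountableTopology (InfiniteAdeleRing L) := secondCountableTopology_infiniteAdeleRing L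
  haveI : SecondCountableTopology (InfiniteAdeleRing ↥(maximalRealSubfield L)) := secondCountableTopology_infiniteAdeleRing _
  obtain ⟨cF, hcF, hF⟩ := exists_integral_adele_eq_smul_integral_prod ↥(maximalRealSubfield L) μF μF₁ μF₂
  obtain ⟨cE, hcE, hE⟩ := exists_integral_adele_eq_smul_integral_prod L μE μE₁ μE₂
  obtain ⟨C', hC', hfinite⟩ := exists_pos_integral_prod_chiWeight_mul_heightFactor_cpow_eq L hcδ hδ hd μF₂ μE₂ νv hφ hψ hres
  have hκE : 0 < (μE (adeleFundamentalDomain L)).toReal⁻¹ := inv_pos.2 (measure_adeleFundamentalDomain_toReal_pos μE)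
  have hκF : 0 < (μF (adeleFundamentalDomain ↥(maximalRealSubfield L))).toReal⁻¹ := inv_pos.2 (measure_adeleFundamentalDomain_toReal_pos μF)
  have hbox : 0 < ((Measure.pi fun _ : Fin 3 => μF₂) (offBox (K := ↥(maximalRealSubfield L)) (ι := Fin 3) ∅)).toReal :=
    ENNReal.toReal_pos (measure_offBox_empty_pos ↥(maximalRealSubfield L) (Fin 3) _).ne' (measure_offBox_empty_lt_top ↥(maximalRealSubfield L) (Fin 3) _).ne
  refine ⟨(μE (adeleFundamentalDomain L)).toReal⁻¹ * cE * ((μF (adeleFundamentalDomain ↥(maximalRealSubfield L))).toReal⁻¹ * cF) *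
      (C' * ((Measure.pi fun _ : Fin 3 => μF₂) (offBox (K := ↥(maximalRealSubfield L)) (ι := Fin 3) ∅)).toReal), by positivity,
    fun S₀ hgood z hz ω hωc hω1 Ainf Ω hΩ T hT hfac hfin hin hsp => ?_⟩
  -- ★ (ν-1): unfold `N(𝔸)` along the Heisenberg chart and the trace-zero line; then the factorisation letter `hfac`
  rw [inv_measure_smul_integral_eq_heisChart_traceZeroLine_three hcδ hδ hc μF μE ν h𝓕 hT]
  simp_rw [hfac]
  -- the `s`-integral: `𝔸_{L⁺} = L⁺_∞ × 𝔸_{L⁺,f}`, then `integral_prod_mul`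
  have hinner : ∀ X : AdeleRing (𝓞 L) L,
      ∫ s : AdeleRing (𝓞 ↥(maximalRealSubfield L)) ↥(maximalRealSubfield L), Ainf (X.1) (s.1) *
          (Ω (X.2) (s.2) * ((((∏ᶠ w : HeightOneSpectrum (𝓞 L), max 1 (max ‖((X) : AdeleRing (𝓞 L) L).2 w‖₊ ‖(heisZ (c := IsCMField.complexConj L) ((X) : AdeleRing (𝓞 L) L) ((traceZeroLine ↥(maximalRealSubfield L) L (IsCMField.complexConj L) hcδ hδ ((0, s.2) : AdeleRing (𝓞 ↥(maximalRealSubfield L)) ↥(maximalRealSubfield L)) : traceZeroAdele ↥(maximalRealSubfield L) L (IsCMField.complexConj L)) : AdeleRing (𝓞 L) L)).2 w‖₊) : ℝ≥0) : ℝ) : ℂ) ^ (-z))) ∂μF =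
        (cF : ℝ) • ((∫ a : InfiniteAdeleRing ↥(maximalRealSubfield L), Ainf (X.1) (a) ∂μF₁) *
          ∫ b : FiniteAdeleRing (𝓞 ↥(maximalRealSubfield L)) ↥(maximalRealSubfield L), (Ω (X.2) (b) * ((((∏ᶠ w : HeightOneSpectrum (𝓞 L), max 1 (max ‖((((0 : InfiniteAdeleRing L)), X.2) : AdeleRing (𝓞 L) L).2 w‖₊ ‖(heisZ (c := IsCMField.complexConj L) ((((0 : InfiniteAdeleRing L)), X.2) : AdeleRing (𝓞 L) L) ((traceZeroLine ↥(maximalRealSubfield L) L (IsCMField.complexConj L) hcδ hδ ((0, b) : AdeleRing (𝓞 ↥(maximalRealSubfield L)) ↥(maximalRealSubfield L)) : traceZeroAdele ↥(maximalRealSubfield L) L (IsCMField.complexConj L)) : AdeleRing (𝓞 L) L)).2 w‖₊) : ℝ≥0) : ℝ) : ℂ) ^ (-z))) ∂μF₂) := by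
    intro X
    rw [hF (fun a b => Ainf (X.1) (a) *
      (Ω (X.2) (b) * ((((∏ᶠ w : HeightOneSpectrum (𝓞 L), max 1 (max ‖((X) : AdeleRing (𝓞 L) L).2 w‖₊ ‖(heisZ (c := IsCMField.complexConj L) ((X) : AdeleRing (𝓞 L) L) ((traceZeroLine ↥(maximalRealSubfield L) L (IsCMField.complexConj L) hcδ hδ ((0, b) : AdeleRing (𝓞 ↥(maximalRealSubfield L)) ↥(maximalRealSubfield L)) : traceZeroAdele ↥(maximalRealSubfield L) L (IsCMField.complexConj L)) : AdeleRing (𝓞 L) L)).2 w‖₊) : ℝ≥0) : ℝ) : ℂ) ^ (-z)))),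
      integral_prod_mul (μ := μF₁) (ν := μF₂) (fun a : InfiniteAdeleRing ↥(maximalRealSubfield L) => Ainf (X.1) (a))
        (fun b : FiniteAdeleRing (𝓞 ↥(maximalRealSubfield L)) ↥(maximalRealSubfield L) => (Ω (X.2) (b) * ((((∏ᶠ w : HeightOneSpectrum (𝓞 L), max 1 (max ‖((X) : AdeleRing (𝓞 L) L).2 w‖₊ ‖(heisZ (c := IsCMField.complexConj L) ((X) : AdeleRing (𝓞 L) L) ((traceZeroLine ↥(maximalRealSubfield L) L (IsCMField.complexConj L) hcδ hδ ((0, b) : AdeleRing (𝓞 ↥(maximalRealSubfield L)) ↥(maximalRealSubfield L)) : traceZeroAdele ↥(maximalRealSubfield L) L (IsCMField.complexConj L)) : AdeleRing (𝓞 L) L)).2 w‖₊) : ℝ≥0) : ℝ) : ℂ) ^ (-z))))]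
    rfl
  simp_rw [hinner]
  -- the `X`-integral: `𝔸_L = L_∞ × 𝔸_{L,f}`, then `integral_prod_mul`
  rw [hE (fun x1 x2 => ((μF (adeleFundamentalDomain ↥(maximalRealSubfield L))).toReal⁻¹ : ℂ) * ((cF : ℝ) • ((∫ a : InfiniteAdeleRing ↥(maximalRealSubfield L), Ainf (x1) (a) ∂μF₁) *
      ∫ b : FiniteAdeleRing (𝓞 ↥(maximalRealSubfield L)) ↥(maximalRealSubfield L), (Ω (x2) (b) * ((((∏ᶠ w : HeightOneSpectrum (𝓞 L), max 1 (max ‖((((0 : InfiniteAdeleRing L)), x2) : AdeleRing (𝓞 L) L).2 w‖₊ ‖(heisZ (c := IsCMField.complexConj L) ((((0 : InfiniteAdeleRing L)), x2) : AdeleRing (𝓞 L) L) ((traceZeroLine ↥(maximalRealSubfield L) L (IsCMField.complexConj L) hcδ hδ ((0, b) : AdeleRing (𝓞 ↥(maximalRealSubfield L)) ↥(maximalRealSubfield L)) : traceZeroAdele ↥(maximalRealSubfield L) L (IsCMField.complexConj L)) : AdeleRing (𝓞 L) L)).2 w‖₊) : ℝ≥0) : ℝ) : ℂ) ^ (-z)))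 ∂μF₂)))]
  simp_rw [Complex.real_smul]
  rw [integral_const_mul, integral_const_mul,
    integral_prod_mul (μ := μE₁) (ν := μE₂) (fun x1 : InfiniteAdeleRing L => ∫ a : InfiniteAdeleRing ↥(maximalRealSubfield L), Ainf (x1) (a) ∂μF₁)
      (fun x2 : FiniteAdeleRing (𝓞 L) L => ∫ b : FiniteAdeleRing (𝓞 ↥(maximalRealSubfield L)) ↥(maximalRealSubfield L), (Ω (x2) (b) * ((((∏ᶠ w : HeightOneSpectrum (𝓞 L), max 1 (max ‖((((0 : InfiniteAdeleRing L)), x2) : AdeleRing (𝓞 L) L).2 w‖₊ ‖(heisZ (c := IsCMField.complexConj L) ((((0 : InfiniteAdeleRing L)), x2) : AdeleRing (𝓞 L) L) ((traceZeroLine ↥(maximalRealSubfield L) L (IsCMField.complexConj L) hcδ hδ ((0, b) : AdeleRing (𝓞 ↥(maximalRealSubfield L)) ↥(maximalRealSubfield L)) : traceZeroAdele ↥(maximalRealSubfield L) L (IsCMField.complexConj L)) : AdeleRing (𝓞 L) L)).2 w‖₊) : ℝ≥0) : ℝ) : ℂ) ^ (-z))) ∂μF₂)]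
  -- Fubini on the finite part (the letter `hfin`), then ★ (a-2a)
  have hfub : ∫ x2 : FiniteAdeleRing (𝓞 L) L, ∫ b : FiniteAdeleRing (𝓞 ↥(maximalRealSubfield L)) ↥(maximalRealSubfield L), (Ω (x2) (b) * ((((∏ᶠ w : HeightOneSpectrum (𝓞 L), max 1 (max ‖((((0 : InfiniteAdeleRing L)), x2) : AdeleRing (𝓞 L) L).2 w‖₊ ‖(heisZ (c := IsCMField.complexConj L) ((((0 : InfiniteAdeleRing L)), x2) : AdeleRing (𝓞 L) L) ((traceZeroLine ↥(maximalRealSubfield L) L (IsCMField.complexConj L) hcδ hδ ((0, b) : AdeleRing (𝓞 ↥(maximalRealSubfield L)) ↥(maximalRealSubfield L)) : traceZeroAdele ↥(maximalRealSubfield L) L (IsCMField.complexConj L)) : AdeleRing (𝓞 L) L)).2 w‖₊) : ℝ≥0) : ℝ) : ℂ) ^ (-z))) ∂μF₂ ∂μE₂ =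
      ∫ q : FiniteAdeleRing (𝓞 L) L × FiniteAdeleRing (𝓞 ↥(maximalRealSubfield L)) ↥(maximalRealSubfield L), (Ω (q.1) (q.2) * ((((∏ᶠ w : HeightOneSpectrum (𝓞 L), max 1 (max ‖((((0 : InfiniteAdeleRing L)), q.1) : AdeleRing (𝓞 L) L).2 w‖₊ ‖(heisZ (c := IsCMField.complexConj L) ((((0 : InfiniteAdeleRing L)), q.1) : AdeleRing (𝓞 L) L) ((traceZeroLine ↥(maximalRealSubfield L) L (IsCMField.complexConj L) hcδ hδ ((0, q.2) : AdeleRing (𝓞 ↥(maximalRealSubfield L)) ↥(maximalRealSubfield L)) : traceZeroAdele ↥(maximalRealSubfield L) L (IsCMField.complexConj L)) : AdeleRing (𝓞 L) L)).2 w‖₊) : ℝ≥0) : ℝ) : ℂ) ^ (-z))) ∂(μE₂.prod μF₂) :=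
    (integral_prod _ hfin).symm
  rw [hfub, hfinite 0 S₀ hgood hz ω hωc hω1 Ω hΩ hfin hin hsp]
  simp only [Complex.real_smul]
  push_cast
  ring


end Summit.HodgeConjecture.HodgeConjecture.Cruxes.H413.K2E1ChiIntertwiningScalarEulerProductU3

end
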